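/-
Copyright (c) 2026 the pub-hodgecm-mathlib formalisation cell (harness21).  Prover seat hodgecm-mathlib-K2E1-p15 (g3), Track B ∕ K2-LIT, h413 = `stmt-HodgeConjecture-24833`,
R90-TF section S8 «ContSpec-n½» (planner R90-CS-plan (g0), item S8B#7 of `SOCKET-PLAN.v1.1`; hand p02 of DEAL-S8-WAVE1, dealt to this seat by LEAD #15): the UNITARY SCHUR DICHOTOMY,
a file-independent Hilbert-space support lemma for file B `R90_S8_ResidualSpectrumU3B`.
-/
import Literature.NumberTheory.Automorphic.HilbertRepSpectrumProofs   -- ★ `ClosedSubrep.exists_le_orthogonal_areUnitarilyEquivalent` (isometric part of a compressed projection, over ★ Schur `HilbertRepSchur`), ★ `isTopIrreducible_congr`; brings ★ `HilbertRepSpectrum`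
import HarnessLib

/-!
# S8B#7 — `R90S8UnitarySchurDichotomy`: an irreducible closed subrepresentation of a unitary representation is either orthogonal to a given closed subrepresentation `B` or unitarily equivalent to an irreducible closed subrepresentation of `B`

Track B ∕ K2-LIT, crux h413 = `stmt-HodgeConjecture-24833`, route of record `HCCMUnconditional`; cell `hodgecm-mathlib`, R90-TF programme, section S8
«ContSpec-n½» (§13.9 residual spectrum), support lemma S8B#7 of the S8 socket plan (signature = the planner's probe `S8B7-signatures.probe.lean`, verbatim; statement audited
CLEAN by R90-CS-audit1 2026-09-04T15:40:38Z).  THEOREMS ONLY (no `def`, no `instance`, no `notation`, no named-fact hypothesis, no `sorry`; default heartbeats); lane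
`--supports stmt-HodgeConjecture-24833 --as helper` (count-neutral).

THE MATHEMATICS ([DeitmarEchterhoff2014, Lemma 6.1.7 (Schur), Cor. 6.1.9 and its proof]; [Dixmier1977, §5.4, §13.1]).  Let `π` be a unitary representation of `G` on a complex
Hilbert space `H`, `B ≤ H` a closed invariant subspace and `P ≤ H` a closed invariant subspace on which `π` is topologically irreducible.  Since `π` is unitary, `Bᗮ` is
invariant (★ `ClosedSubrep.orthogonal`).  EITHER `P ≤ Bᗮ`, i.e. `P ⟂ B`; OR `P ⊄ Bᗮ`, and then the compression `T := P_B|_P : P → (Bᗮ)ᗮ = B` of the orthogonal projection is a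
NON-ZERO bounded intertwiner, `T⋆T ∈ End_G(P)` is a scalar `λ > 0` by Schur's lemma for the irreducible unitary `P` (★ `IsTopIrreducible.exists_eq_algebraMap_of_commute`,
`HilbertRepSchur`), `U := λ^{-1∕2} T` is an isometric intertwiner and `P′ := U(P) ≤ B` is a closed invariant subspace unitarily equivalent to `P` — all of this is ★
`ClosedSubrep.exists_le_orthogonal_areUnitarilyEquivalent` (`HilbertRepSpectrumProofs`) applied to `W := Bᗮ`, with `(Bᗮ)ᗮ = B` (★ `ClosedSubrep.orthogonal_orthogonal`);
finally `P′` is irreducible because topological irreducibility is invariant under equivalence (★ `isTopIrreducible_congr`).  NO new analysis: this file is an ASSEMBLY of ★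
generic lemmas into the dichotomy the S8 payment `sock_S8_res_cuspidal_of_not_piN` (wave 2, S8B#6) consumes with `B := L²_res`.
* §1 **`isOrtho_or_equiv_of_isTopIrreducible`** — THE HEAD (S8B#7).
HONEST LABEL: HC_CM is proved only modulo the 7 printed citations (2 remaining named inputs: hLiu418 = `stmt-HodgeConjecture-24832`, h413 = `stmt-HodgeConjecture-24833`) until
rung 0 closes; this file asserts no named fact and closes no socket; count-neutral.

## References
* [DeitmarEchterhoff2014] A. Deitmar, S. Echterhoff, *Principles of Harmonic Analysis*, 2nd ed. (Springer, 2014), Lemma 6.1.7, Cor. 6.1.9.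
* [Dixmier1977] J. Dixmier, *C\*-algebras* (North-Holland, 1977), §5.4, §13.1.
-/

set_option autoImplicit false
set_option linter.dupNamespace false  -- the mandated namespace `…HodgeConjecture.HodgeConjecture.R90.S8` (LEAD #1 L1) repeats the summit's segment

noncomputable section

namespace Summit.HodgeConjecture.HodgeConjecture.R90.S8

open ContRepresentation

variable {G H : Type*} [Group G] [NormedAddCommGroup H] [InnerProductSpace ℂ H] [CompleteSpace H]
  {π : ContRepresentation ℂ G H}

/-! ## §1 The head: the unitary Schur dichotomy -/

/-- **S8B#7 — unitary Schur dichotomy.**  For a unitary representation `π`, a closed subrepresentation `B` and a topologically irreducible closed subrepresentation `P`: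
either `P ⟂ B`, or `P` is unitarily equivalent to an irreducible closed subrepresentation `P′ ≤ B` (the isometric part of the compressed projection `P_B|_P`, scalar
`T⋆T` by Schur).  Assembly of ★ `ClosedSubrep.exists_le_orthogonal_areUnitarilyEquivalent` at `W := Bᗮ`, ★ `ClosedSubrep.orthogonal_orthogonal` and ★
`isTopIrreducible_congr` [cite: DeitmarEchterhoff2014, Lemma 6.1.7, Cor. 6.1.9]. -/
theorem isOrtho_or_equiv_of_isTopIrreducible (hπ : π.IsUnitary)
    (B P : ClosedSubrep π) (hP : P.toContRep.IsTopIrreducible) :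
    P.toSubmodule ⟂ B.toSubmodule ∨
      ∃ P' : ClosedSubrep π, P' ≤ B ∧ P'.toContRep.IsTopIrreducible ∧
        AreUnitarilyEquivalent P.toContRep P'.toContRep := by
  by_cases hle : P ≤ B.orthogonal hπ
  · -- `P ≤ Bᗮ`, i.e. `P ⟂ B`
    left
    rw [Submodule.isOrtho_iff_le]
    exact (ClosedSubrep.toSubmodule_le_iff.mpr hle).trans_eq (ClosedSubrep.toSubmodule_orthogonal hπ B)
  · -- `P ⊄ Bᗮ`: the isometric part of the compressed projection lands in `(Bᗮ)ᗮ = B`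
    right
    obtain ⟨P', hP'le, e, he⟩ :=
      ClosedSubrep.exists_le_orthogonal_areUnitarilyEquivalent hπ (B.orthogonal hπ) P hP hle
    rw [ClosedSubrep.orthogonal_orthogonal] at hP'le
    exact ⟨P', hP'le, (isTopIrreducible_congr e).mp hP, e, he⟩

end Summit.HodgeConjecture.HodgeConjecture.R90.S8

end
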